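import Summits.BirchSwinnertonDyer.BirchSwinnertonDyer.Theses.UniversalToricDescent
import Summits.BirchSwinnertonDyer.BirchSwinnertonDyer.Theorems.UniversalToricDescentTwinSignatureDivision
import Summits.BirchSwinnertonDyer.BirchSwinnertonDyer.Theorems.UniversalToricDescentStrictPlaceGrowthReduction
import HarnessLib

/-!
# Stub TS2-ASSEMBLY of line `sigmacongruence` (crux ♭T≤ stmt-BirchSwinnertonDyer-23042): COUNT + DIV + TORS ⇒ TS2′

Lead prover `bsd-wall-utd-p1` g17 (stub mode, `--supports stmt-BirchSwinnertonDyer-23042`). THEOREMS ONLY; no definition,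
no named fact, no `sorry`. BSD is not proved by any of this.

Abstract algebra (no Poitou–Tate). `Y = Sel_{𝔭′}^{S∪{v}}(K_∞, E′[3^∞]) ⊇ Y₀ = Sel_{𝔭′}^{S}`, `Λ : Y → Sig_v` the `v`-signature
map `s ↦ (σ ↦ res_{kerD κ v}(conj_σ s))`; `Λ s = 0 ⇒ s ∈ Y₀` (the condition at `v`, `mem_selmerOver_iff_awayKer`). If a
signature `F` (killed by `3^{k₀}`, TORS) is NOT a value of `Λ`, divide it `m = C + 1` times (DIV lifted to signatures along
`σ = d γ^i h`): `3^m G = F`. The `m · #Λ(Y[3^k])` signatures `3^i G + Λ s` (`i < m`, `s ∈ Y[3^k]`, `k = k₀ + m`) are pairwise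
distinct (a coincidence gives `(3^{j-i} − 1) F ∈ Λ(Y)`, and `3^{j-i} − 1` is a unit modulo `3^{k₀}`), so COUNT gives
`#Y₀[3^k] · m · #Λ(Y[3^k]) ≤ C · #Y[3^k] ≤ C · #Y₀[3^k] · #Λ(Y[3^k])` (fibres of `Λ` on `Y[3^k]` are cosets of `Y₀[3^k]`),
i.e. `m ≤ C`: contradiction.

Helpers (`sig_of_mem`, `mem_selmerAc_of_forall_resKerD_eq_zero`, `exists_sig_smul_eq`, `finite_torsionBy_pow`) are in
`Theorems/UniversalToricDescentTwinSignatureDivision.lean`; this file proves the registered stub `stub_twinSigmaSurjOfCount` verbatim.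

References: [GreenbergVatsal2000] §2 Prop. (2.1), Cor. (2.3) (pp. 23–25); [Washington1997] §13.1.
-/

set_option autoImplicit false
-- `…BirchSwinnertonDyer.BirchSwinnertonDyer…` is the problem's mandated namespace (D-0017).
set_option linter.dupNamespace false

noncomputable section

open scoped Classical

namespace Summit.BirchSwinnertonDyer.BirchSwinnertonDyer.Cruxes.DefectTransportModThreePT.SigmaCongruence

open WeierstrassCurve NumberField IsDedekindDomain Field
  Literature.NumberTheory.EllipticCurves
  Literature.NumberTheory.EllipticCurves.Rank1Residual
  Literature.NumberTheory.EllipticCurves.GreenbergSelmer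
  Literature.NumberTheory.GaloisRepresentations
  Summit.BirchSwinnertonDyer.Rank1Residual Summit.BirchSwinnertonDyer.Rank1Residual.X11b
  Summit.BirchSwinnertonDyer.Rank1Residual.X11b.AcSelmer Summit.BirchSwinnertonDyer.Rank1Residual.X11b.Coinv
  Summit.BirchSwinnertonDyer.BirchSwinnertonDyer.Theorems
  Summit.BirchSwinnertonDyer.BirchSwinnertonDyer.Theorems.UniversalToricDescentTwinSignatureDivision



set_option maxHeartbeats 400000 in
/-- **STUB TS2-ASSEMBLY (v6) — PROVED.** See the module docstring. [cite: GreenbergVatsal2000, §2 Prop. (2.1), Cor. (2.3) (pp. 23–25)] -/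
theorem stub_twinSigmaSurjOfCount :
    Summit.BirchSwinnertonDyer.BirchSwinnertonDyer.Theses.UniversalToricDescent.PoitouTateSelmerStructureDualityFact →
    Summit.BirchSwinnertonDyer.BirchSwinnertonDyer.Theses.UniversalToricDescent.PoitouTateShaTateDualFact →
    ∀ (W' : WeierstrassCurve ℚ) [W'.IsElliptic] [W'.IsGloballyMinimal] (K : Type) [Field K] [NumberField K],
      ¬ Addv W' 3 → IsImaginaryQuadratic K → SplitsIn K 3 →
      ∀ (κ : ZpExtension K 3), κ.IsAnticyclotomic → ∀ (γ : absoluteGaloisGroup K) [Fact (κ.IsTopGenerator γ)]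
      (𝔭 𝔭' : HeightOneSpectrum (𝓞 K)), ((3 : ℕ) : 𝓞 K) ∈ 𝔭.asIdeal → ((3 : ℕ) : 𝓞 K) ∈ 𝔭'.asIdeal → 𝔭 ≠ 𝔭' →
      (∀ m : (W'.baseChange K).geomPrimaryTorsion 3, (∀ σ ∈ κ.kerSubgroup, σ • m = m) → 3 • m = 0 → m = 0) →
      ∀ (S : Set (HeightOneSpectrum (𝓞 K))), S.Finite →
      (∀ v ∈ S, ((3 : ℕ) : 𝓞 K) ∉ v.asIdeal ∧ ¬ (decomp v ≤ κ.kerSubgroup)) →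
      ∀ (v : HeightOneSpectrum (𝓞 K)), ((3 : ℕ) : 𝓞 K) ∉ v.asIdeal → v ∉ S → ¬ (decomp v ≤ κ.kerSubgroup) →
      Set.Finite {s : selmerAc (W'.baseChange K) 3 κ 𝔭' (insert v S) | 3 • s = 0} →
      (∃ C : ℕ, ∀ (k : ℕ) (Φ : Finset (absoluteGaloisGroup K → subgroupH1 (kerD κ v) ((W'.baseChange K).geomPrimaryTorsion 3))),
        (∀ F ∈ Φ, (∀ (σ h : absoluteGaloisGroup K), h ∈ κ.kerSubgroup → F (σ * h) = F σ) ∧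
          (∀ (d : decomp (K := K) v) (σ : absoluteGaloisGroup K), F ((d : absoluteGaloisGroup K) * σ) =
            conjH1 (kerD κ v) ((W'.baseChange K).geomPrimaryTorsion 3) d (F σ)) ∧ 3 ^ k • F = 0) →
        Nat.card {s : selmerAc (W'.baseChange K) 3 κ 𝔭' S // 3 ^ k • s = 0} * Φ.card ≤
          C * Nat.card {s : selmerAc (W'.baseChange K) 3 κ 𝔭' (insert v S) // 3 ^ k • s = 0}) →
      (∀ y : subgroupH1 (kerD κ v) ((W'.baseChange K).geomPrimaryTorsion 3),
        ∃ z : subgroupH1 (kerD κ v) ((W'.baseChange K).geomPrimaryTorsion 3), 3 • z = y) →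
      (∀ (F : (absoluteGaloisGroup K → subgroupH1 (kerD κ v) ((W'.baseChange K).geomPrimaryTorsion 3))),
        (∀ (σ h : absoluteGaloisGroup K), h ∈ κ.kerSubgroup → F (σ * h) = F σ) →
        (∀ (d : decomp (K := K) v) (σ : absoluteGaloisGroup K), F ((d : absoluteGaloisGroup K) * σ) =
          conjH1 (kerD κ v) ((W'.baseChange K).geomPrimaryTorsion 3) d (F σ)) →
        ∃ k : ℕ, 3 ^ k • F = 0) →
      ∀ (F : (absoluteGaloisGroup K → subgroupH1 (kerD κ v) ((W'.baseChange K).geomPrimaryTorsion 3))),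
      (∀ (σ h : absoluteGaloisGroup K), h ∈ κ.kerSubgroup → F (σ * h) = F σ) →
      (∀ (d : decomp (K := K) v) (σ : absoluteGaloisGroup K), F ((d : absoluteGaloisGroup K) * σ) =
        conjH1 (kerD κ v) ((W'.baseChange K).geomPrimaryTorsion 3) d (F σ)) →
      ∃ s ∈ selmerAc (W'.baseChange K) 3 κ 𝔭' (insert v S), ∀ σ : absoluteGaloisGroup K,
        resKerD κ ((W'.baseChange K).geomPrimaryTorsion 3) v ((W'.baseChange K).conjH1 3 κ.kerSubgroup σ s) = F σ := by
  intro _ _ W' _ _ K _ _ _ _ _ κ _ γ _ 𝔭 𝔭' _ _ _ _ S _ _ v _ _ hvd hfin hC hdiv htors F hFH hFD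
  haveI : Fact (Nat.Prime 3) := ⟨Nat.prime_three⟩
  obtain ⟨C, hC⟩ := hC
  -- the signature map (pointwise)
  obtain ⟨Λ, hΛ⟩ : ∃ Λ : (W'.baseChange K).subgroupH1 3 κ.kerSubgroup →
      absoluteGaloisGroup K → subgroupH1 (kerD κ v) ((W'.baseChange K).geomPrimaryTorsion 3),
      ∀ s σ, Λ s σ = resKerD κ ((W'.baseChange K).geomPrimaryTorsion 3) v ((W'.baseChange K).conjH1 3 κ.kerSubgroup σ s) :=
    ⟨fun s σ ↦ resKerD κ _ v ((W'.baseChange K).conjH1 3 κ.kerSubgroup σ s), fun _ _ ↦ rfl⟩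
  set Y : AddSubgroup ((W'.baseChange K).subgroupH1 3 κ.kerSubgroup) := selmerAc (W'.baseChange K) 3 κ 𝔭' (insert v S)
    with hY
  set Y₀ : AddSubgroup ((W'.baseChange K).subgroupH1 3 κ.kerSubgroup) := selmerAc (W'.baseChange K) 3 κ 𝔭' S with hY₀
  have hΛadd : ∀ s t σ, Λ (s + t) σ = Λ s σ + Λ t σ := fun s t σ ↦ by rw [hΛ, hΛ, hΛ, map_add, map_add]
  have hΛsub : ∀ s t σ, Λ (s - t) σ = Λ s σ - Λ t σ := fun s t σ ↦ by rw [hΛ, hΛ, hΛ, map_sub, map_sub]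
  have hΛnsmul : ∀ (n : ℕ) s σ, Λ (n • s) σ = n • Λ s σ := fun n s σ ↦ by rw [hΛ, hΛ, map_nsmul, map_nsmul]
  have hΛneg : ∀ s σ, Λ (-s) σ = -Λ s σ := fun s σ ↦ by rw [hΛ, hΛ, map_neg, map_neg]
  have hΛzero : ∀ σ, Λ 0 σ = 0 := fun σ ↦ by rw [hΛ, map_zero, map_zero]
  -- pointwise readings of function identities
  have hpt_smul : ∀ (n : ℕ) (G : absoluteGaloisGroup K → subgroupH1 (kerD κ v) ((W'.baseChange K).geomPrimaryTorsion 3))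
      (σ : absoluteGaloisGroup K), (n • G) σ = n • G σ := fun _ _ _ ↦ rfl
  have hpt_add : ∀ (G G' : absoluteGaloisGroup K → subgroupH1 (kerD κ v) ((W'.baseChange K).geomPrimaryTorsion 3))
      (σ : absoluteGaloisGroup K), (G + G') σ = G σ + G' σ := fun _ _ _ ↦ rfl
  by_contra hnot
  have hnotim : ∀ s : (W'.baseChange K).subgroupH1 3 κ.kerSubgroup, s ∈ Y → ¬ ∀ σ, Λ s σ = F σ := fun s hs e ↦
    hnot ⟨s, hs, fun σ ↦ by rw [← hΛ]; exact e σ⟩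
  -- `F` is killed by `3^k₀`
  obtain ⟨k₀, hk₀⟩ := htors F hFH hFD
  have hk₀σ : ∀ σ, 3 ^ k₀ • F σ = 0 := fun σ ↦ by
    have e := congrFun hk₀ σ; rwa [hpt_smul] at e
  -- divide `F` `m = C + 1` times
  set m := C + 1 with hm
  have hdivSig : ∀ (n : ℕ), ∃ G : absoluteGaloisGroup K → subgroupH1 (kerD κ v) ((W'.baseChange K).geomPrimaryTorsion 3),
      (∀ (σ h : absoluteGaloisGroup K), h ∈ κ.kerSubgroup → G (σ * h) = G σ) ∧
      (∀ (d : decomp (K := K) v) (σ : absoluteGaloisGroup K), G ((d : absoluteGaloisGroup K) * σ) =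
        conjH1 (kerD κ v) ((W'.baseChange K).geomPrimaryTorsion 3) d (G σ)) ∧ ∀ σ, 3 ^ n • G σ = F σ := by
    intro n
    induction n with
    | zero => exact ⟨F, hFH, hFD, fun σ ↦ by rw [pow_zero, one_nsmul]⟩
    | succ n ih =>
      obtain ⟨G, hGH, hGD, hG⟩ := ih
      obtain ⟨G', hG'H, hG'D, hG'⟩ := exists_sig_smul_eq (W'.baseChange K) 3 κ v hvd hdiv G hGH hGD
      refine ⟨G', hG'H, hG'D, fun σ ↦ ?_⟩
      have e := congrFun hG' σ
      rw [hpt_smul] at e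
      rw [pow_succ, mul_nsmul', e, hG]
  obtain ⟨G, hGH, hGD, hG⟩ := hdivSig m
  obtain ⟨k, hk⟩ : ∃ k : ℕ, k = k₀ + m := ⟨_, rfl⟩
  -- the finite sets
  have hfinY : Set.Finite {s : Y | 3 ^ k • s = 0} := finite_torsionBy_pow Y 3 hfin k
  have hY₀le : Y₀ ≤ Y := by
    simp only [hY₀, hY]
    exact selmerOver_mono (Set.subset_insert v S)
  have hfinY₀ : Set.Finite {s : Y₀ | 3 ^ k • s = 0} := by
    -- through the GENERIC injection `Y₀[3^k] ↪ Y[3^k]` (no element-level comparison of the two subtypes here)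
    obtain ⟨ι, hι⟩ := UniversalToricDescentStrictPlaceGrowth.exists_injective_subtype_of_coe_mem
      (A := Y₀) (B := Y) (fun _ ↦ True) (3 ^ k) (fun a _ ↦ hY₀le a.2)
    have hfinA : Finite {a : Y₀ // True ∧ 3 ^ k • a = 0} := @Finite.of_injective _ _ hfinY.to_subtype ι hι
    have hfinB : Finite {a : Y₀ // 3 ^ k • a = 0} :=
      @Finite.of_equiv _ _ hfinA (Equiv.subtypeEquivRight fun a ↦ by simp only [true_and])
    exact Set.finite_coe_iff.mp hfinB
  set T : Finset Y := hfinY.toFinset with hT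
  set T₀ : Finset Y₀ := hfinY₀.toFinset with hT₀
  set Λk : Finset (absoluteGaloisGroup K → subgroupH1 (kerD κ v) ((W'.baseChange K).geomPrimaryTorsion 3)) :=
    T.image (fun s : Y ↦ Λ (s : (W'.baseChange K).subgroupH1 3 κ.kerSubgroup)) with hΛk
  have hcardY : Nat.card {s : Y // 3 ^ k • s = 0} = T.card := by
    rw [hT, ← Set.ncard_eq_toFinset_card _ hfinY, ← Nat.card_coe_set_eq]; rfl
  have hcardY₀ : Nat.card {s : Y₀ // 3 ^ k • s = 0} = T₀.card := by
    rw [hT₀, ← Set.ncard_eq_toFinset_card _ hfinY₀, ← Nat.card_coe_set_eq]; rfl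
  -- coercion readings of torsion in `Y`
  have hcoeT : ∀ s : Y, s ∈ T → 3 ^ k • (s : (W'.baseChange K).subgroupH1 3 κ.kerSubgroup) = 0 := by
    intro s hs
    have hs' : 3 ^ k • s = 0 := by
      rw [hT, Set.Finite.mem_toFinset] at hs
      exact hs
    have e := congrArg (fun t : Y ↦ (t : (W'.baseChange K).subgroupH1 3 κ.kerSubgroup)) hs'
    simp only [AddSubgroupClass.coe_nsmul, ZeroMemClass.coe_zero] at e
    exact e
  -- (1) fibre bound: `#Y[3^k] ≤ #Y₀[3^k] · #Λk`
  have hfib : T.card ≤ T₀.card * Λk.card := by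
    refine Finset.card_le_mul_card_image (f := fun s : Y ↦ Λ (s : (W'.baseChange K).subgroupH1 3 κ.kerSubgroup))
      T T₀.card fun b hb ↦ ?_
    obtain ⟨s₀, hs₀T, hs₀b⟩ := Finset.mem_image.mp hb
    let ι : Y₀ → (W'.baseChange K).subgroupH1 3 κ.kerSubgroup := fun t ↦ (t : (W'.baseChange K).subgroupH1 3 κ.kerSubgroup)
    refine (Finset.card_le_card_of_injOn (fun s : Y ↦ (s : (W'.baseChange K).subgroupH1 3 κ.kerSubgroup) - s₀)
      (t := T₀.image ι) (fun s hs ↦ ?_) (fun a _ b _ e ↦ Subtype.ext (sub_left_injective e))).trans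
      Finset.card_image_le
    rw [Finset.mem_coe, Finset.mem_filter] at hs
    obtain ⟨hsT, hsb⟩ := hs
    have hsk := hcoeT s hsT
    have hs₀k := hcoeT s₀ hs₀T
    -- `s - s₀ ∈ Y₀`
    have hmem : ((s : (W'.baseChange K).subgroupH1 3 κ.kerSubgroup) - s₀) ∈ Y₀ := by
      refine mem_selmerAc_of_forall_resKerD_eq_zero (W'.baseChange K) 3 κ v 𝔭' S (Y.sub_mem s.2 s₀.2) fun σ ↦ ?_
      rw [← hΛ, hΛsub, show Λ (s : (W'.baseChange K).subgroupH1 3 κ.kerSubgroup) σ = b σ from congrFun hsb σ,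
        show Λ (s₀ : (W'.baseChange K).subgroupH1 3 κ.kerSubgroup) σ = b σ from congrFun hs₀b σ, sub_self]
    refine Finset.mem_coe.2 (Finset.mem_image.mpr ⟨⟨_, hmem⟩, ?_, rfl⟩)
    simp only [hT₀, Set.Finite.mem_toFinset, Set.mem_setOf_eq]
    apply Subtype.ext
    rw [AddSubgroupClass.coe_nsmul, ZeroMemClass.coe_zero]
    change 3 ^ k • ((s : (W'.baseChange K).subgroupH1 3 κ.kerSubgroup) - s₀) = 0
    rw [nsmul_sub, hsk, hs₀k, sub_self]
  -- (2) the finite set `Φ = {3^i G + Λ s}` of signatures killed by `3^k`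
  set Φ : Finset (absoluteGaloisGroup K → subgroupH1 (kerD κ v) ((W'.baseChange K).geomPrimaryTorsion 3)) :=
    (Finset.range m ×ˢ Λk).image (fun q ↦ 3 ^ q.1 • G + q.2) with hΦ
  have hΦsig : ∀ F' ∈ Φ, (∀ (σ h : absoluteGaloisGroup K), h ∈ κ.kerSubgroup → F' (σ * h) = F' σ) ∧
      (∀ (d : decomp (K := K) v) (σ : absoluteGaloisGroup K), F' ((d : absoluteGaloisGroup K) * σ) =
        conjH1 (kerD κ v) ((W'.baseChange K).geomPrimaryTorsion 3) d (F' σ)) ∧ 3 ^ k • F' = 0 := by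
    intro F' hF'
    obtain ⟨q, hq, hqF⟩ := Finset.mem_image.mp hF'
    obtain ⟨i, lam⟩ := q
    obtain ⟨hi, hlam⟩ := Finset.mem_product.mp hq
    obtain ⟨s, hsT, hslam⟩ := Finset.mem_image.mp hlam
    dsimp only at hqF hi hlam hslam
    subst hqF
    subst hslam
    have hsk := hcoeT s hsT
    obtain ⟨h1, h2⟩ := sig_of_mem (W'.baseChange K) 3 κ v (s : (W'.baseChange K).subgroupH1 3 κ.kerSubgroup)
    refine ⟨fun σ h hh ↦ ?_, fun d σ ↦ ?_, funext fun σ ↦ ?_⟩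
    · rw [hpt_add, hpt_add, hpt_smul, hpt_smul, hGH σ h hh, hΛ, hΛ, h1 σ h hh]
    · rw [hpt_add, hpt_add, hpt_smul, hpt_smul, hGD d σ, hΛ, hΛ, h2 d σ]
      simp only [map_add, map_nsmul]
    · rw [hpt_smul, hpt_add, hpt_smul, Pi.zero_apply, nsmul_add, ← hΛnsmul, hsk, hΛzero, add_zero, ← mul_nsmul',
        ← pow_add, hk, Nat.add_right_comm k₀ m i, pow_add, mul_nsmul', hG σ, pow_add, mul_comm, mul_nsmul', hk₀σ σ,
        nsmul_zero]
  -- (3) `Φ` has `m · #Λk` elements: a coincidence `3^i G + Λ s = 3^j G + Λ s'` with `i < j` puts `F` in `Λ(Y)`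
  have hunit : ∀ e : ℕ, 0 < e → ∃ u : ℕ, ∀ x : subgroupH1 (kerD κ v) ((W'.baseChange K).geomPrimaryTorsion 3),
      3 ^ k₀ • x = 0 → u • ((3 ^ e - 1) • x) = x := by
    intro e he
    rcases Nat.eq_zero_or_pos k₀ with h0 | h0
    · refine ⟨0, fun x hx ↦ ?_⟩
      rw [h0, pow_zero, one_nsmul] at hx
      subst hx
      rw [nsmul_zero, zero_nsmul]
    have hcop : Nat.Coprime (3 ^ e - 1) (3 ^ k₀) := by
      refine Nat.Coprime.pow_right _ ?_
      have h3 : 3 ^ e - 1 = 3 * (3 ^ (e - 1)) - 1 := by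
        rw [← pow_succ', Nat.sub_add_cancel he]
      rw [Nat.coprime_comm, Nat.Prime.coprime_iff_not_dvd Nat.prime_three, h3]
      have hpos : 0 < 3 * 3 ^ (e - 1) := by positivity
      omega
    have hlt : 1 < 3 ^ k₀ := Nat.one_lt_pow (Nat.pos_iff_ne_zero.mp h0) (by norm_num)
    obtain ⟨u, -, hu⟩ := Nat.exists_mul_mod_eq_one_of_coprime hcop hlt
    refine ⟨u, fun x hx ↦ ?_⟩
    obtain ⟨q, hq⟩ : ∃ q, (3 ^ e - 1) * u = q * 3 ^ k₀ + 1 := ⟨(3 ^ e - 1) * u / 3 ^ k₀, by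
      have := Nat.div_add_mod ((3 ^ e - 1) * u) (3 ^ k₀); rw [hu] at this
      linarith [Nat.mul_comm (3 ^ k₀) ((3 ^ e - 1) * u / 3 ^ k₀)]⟩
    rw [← mul_nsmul, hq, add_nsmul, one_nsmul, mul_nsmul', hx, nsmul_zero, zero_add]
  have hinj : Set.InjOn (fun q : ℕ × (absoluteGaloisGroup K → subgroupH1 (kerD κ v) ((W'.baseChange K).geomPrimaryTorsion 3)) ↦
      3 ^ q.1 • G + q.2) ↑(Finset.range m ×ˢ Λk) := by
    -- core: `i < j` impossible
    have core : ∀ (i j : ℕ) (a b : absoluteGaloisGroup K → subgroupH1 (kerD κ v) ((W'.baseChange K).geomPrimaryTorsion 3)),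
        i < j → j < m → a ∈ Λk → b ∈ Λk → 3 ^ i • G + a = 3 ^ j • G + b → False := by
      intro i j a b hij hjm ha hb e
      obtain ⟨sa, hsa, rfl⟩ := Finset.mem_image.mp ha
      obtain ⟨sb, hsb, rfl⟩ := Finset.mem_image.mp hb
      obtain ⟨u, hu⟩ := hunit (j - i) (Nat.sub_pos_of_lt hij)
      -- the element of `Y` whose signature will be `F`
      set t : (W'.baseChange K).subgroupH1 3 κ.kerSubgroup :=
        (3 ^ (m - i)) • ((sb : (W'.baseChange K).subgroupH1 3 κ.kerSubgroup) - sa) with ht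
      have htY : t ∈ Y := Y.nsmul_mem (Y.sub_mem sb.2 sa.2) _
      apply hnotim (-(u • t)) (Y.neg_mem (Y.nsmul_mem htY u))
      intro σ
      have eσ : 3 ^ i • G σ + Λ (sa : (W'.baseChange K).subgroupH1 3 κ.kerSubgroup) σ =
          3 ^ j • G σ + Λ (sb : (W'.baseChange K).subgroupH1 3 κ.kerSubgroup) σ := by
        have e' := congrFun e σ
        rw [hpt_add, hpt_add, hpt_smul, hpt_smul] at e'
        exact e'
      -- `3^i G σ = 3^j G σ + Λ (sb - sa) σ`
      have e1 : 3 ^ i • G σ = 3 ^ j • G σ + Λ ((sb : (W'.baseChange K).subgroupH1 3 κ.kerSubgroup) - sa) σ := by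
        rw [hΛsub, ← add_sub_assoc, ← eσ, add_sub_cancel_right]
      -- multiply by `3^(m-i)`: `F σ = 3^(j-i) F σ + Λ t σ`
      have e2 : F σ = 3 ^ (j - i) • F σ + Λ t σ := by
        have h := congrArg (fun x ↦ 3 ^ (m - i) • x) e1
        simp only [nsmul_add, ← mul_nsmul', ← pow_add, Nat.sub_add_cancel (hij.le.trans hjm.le)] at h
        rw [hG σ, show m - i + j = (j - i) + m by omega, pow_add, mul_nsmul', hG σ, ← hΛnsmul] at h
        exact h
      -- `(3^(j-i) - 1) F σ = - Λ t σ`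
      have e3 : (3 ^ (j - i) - 1) • F σ = -Λ t σ := by
        have hle1 : 1 ≤ 3 ^ (j - i) := Nat.one_le_pow _ _ (by norm_num)
        have h4 : (3 ^ (j - i) - 1) • F σ + F σ = 3 ^ (j - i) • F σ := by
          rw [← succ_nsmul, Nat.sub_add_cancel hle1]
        rw [eq_neg_iff_add_eq_zero]
        have h5 : (3 ^ (j - i) - 1) • F σ + Λ t σ + F σ = F σ := by rw [add_right_comm, h4, ← e2]
        simpa using h5
      rw [hΛneg, hΛnsmul, ← hu (F σ) (hk₀σ σ), e3, neg_nsmul]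
    intro q₁ hq₁ q₂ hq₂ e
    rw [Finset.coe_product, Set.mem_prod, Finset.mem_coe, Finset.mem_range, Finset.mem_coe] at hq₁ hq₂
    rcases lt_trichotomy q₁.1 q₂.1 with hlt | heq | hgt
    · exact (core _ _ _ _ hlt hq₂.1 hq₁.2 hq₂.2 e).elim
    · have e' : q₁.2 = q₂.2 := by
        have e'' := e
        dsimp only at e''
        rw [heq] at e''
        exact add_left_cancel e''
      exact Prod.ext heq e'
    · exact (core _ _ _ _ hgt hq₁.1 hq₂.2 hq₁.2 e.symm).elim
  have hΦcard : Φ.card = m * Λk.card := by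
    rw [hΦ, Finset.card_image_of_injOn hinj, Finset.card_product, Finset.card_range]
  -- (4) the count and the contradiction
  have hcount := hC k Φ hΦsig
  rw [hcardY, hcardY₀, hΦcard] at hcount
  have hΛkpos : 0 < Λk.card :=
    Finset.card_pos.mpr ⟨_, Finset.mem_image.mpr ⟨0, by rw [hT, Set.Finite.mem_toFinset, Set.mem_setOf_eq, nsmul_zero], rfl⟩⟩
  have hT₀pos : 0 < T₀.card :=
    Finset.card_pos.mpr ⟨0, by rw [hT₀, Set.Finite.mem_toFinset, Set.mem_setOf_eq, nsmul_zero]⟩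
  have h1 : T₀.card * (m * Λk.card) ≤ C * (T₀.card * Λk.card) :=
    hcount.trans (Nat.mul_le_mul_left C hfib)
  have h2 : m * (T₀.card * Λk.card) ≤ C * (T₀.card * Λk.card) := by
    calc m * (T₀.card * Λk.card) = T₀.card * (m * Λk.card) := by ring
      _ ≤ C * (T₀.card * Λk.card) := h1
  have h3 : m ≤ C := Nat.le_of_mul_le_mul_right h2 (Nat.mul_pos hT₀pos hΛkpos)
  omega

end Summit.BirchSwinnertonDyer.BirchSwinnertonDyer.Cruxes.DefectTransportModThreePT.SigmaCongruence

end
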